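import Summits.Ventures.PercRepro.Night2ThreeTwoObstructionThirteen

/-!
# PercRepro — the cell `(3, 2)`: targets that are not «a rank-`2` set plus two points» keep `cap2 ≥ 11/60`
(night-2, gen 26)

Groundwork for the obstruction cells with `|V| ≤ 10` (no global common line).  A thin covering preimage of a target `S`
is a face `S ∖ w` with `w` a coloop of `S ∖ K`; two of them leave `(S ∖ K) ∖ {w, w′}` of rank `2`.  So a target whose
off-coloop part is NOT a rank-`≤ 2` set plus two points (`¬ BadTarget`) has at most ONE thin covering preimage, its
`L1` is at most one request `≤ 7/30`, and `cap2 ≥ 5/12 − 7/30 = 11/60` — eleven times the floor `1/60` of the landed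
good-target argument, and without any line.  Above a covering basis `K ∪ T` the bad targets are exactly the sets
`R ∪ {w, w′}` with `{u, v} ⊆ R ⊆ cl {u, v}` for a pair `{u, v} ⊆ T` (`bad_target_structure`), so they are few.

* `BadTarget`: the off-coloop part is a rank-`≤ 2` set plus two points;
* `card_thin_coverPreimages_le_one_of_not_bad`, `L1_le_of_not_bad`, **`cap2_ge_of_not_bad`**;
* **`bad_target_structure`**: a bad target above a covering basis lies in `cl {u, v} ∪ {w, w′}` for a pair of basis points.
-/

namespace PercRepro.Shadow

open Finset PerFlat ThmH

variable {α : Type*} [DecidableEq α] {M : Matroid α} [M.Finite]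

section NonBad

variable {G : Finset α}

/-- A target is BAD when its off-coloop part is a rank-`≤ 2` set plus two points. -/
def BadTarget (M : Matroid α) [M.Finite] (G S : Finset α) : Prop :=
  ∃ w ∈ S \ coloops M G, ∃ w' ∈ S \ coloops M G, w ≠ w' ∧ rkN M ((S \ coloops M G) \ {w, w'}) ≤ 2

open scoped Classical in
/-- The off-coloop part of a shadow set of the cell has rank `4`. -/
theorem rkN_sdiff_coloops_eq_four (hG : G ∈ flatsQ M (5 + 1)) (hk : kColoops M G = 2) {S : Finset α}
    (hS : S ∈ shadowAt M (5 + 2) 5 (Uq M (5 + 2) 5) G) : rkN M (S \ coloops M G) = 4 := by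
  have hGg : G ⊆ gr M := (mem_flatsQ.1 hG).1
  have hSG : S ⊆ G := subset_G_of_mem_shadowAt hS
  have hKS : coloops M G ⊆ S := coloops_subset_of_mem_shadowAt hS
  have h6 : rkN M S = 6 := by
    have hclS : clF M S = G := (mem_shadowAt.1 hS).2
    have := rkN_clF (M := M) S
    rw [hclS] at this
    have hG6 : M.eRk (G : Set α) = ((5 + 1 : ℕ) : ℕ∞) := (mem_flatsQ.1 hG).2.2
    rw [eRk_eq_rkN] at hG6
    have : rkN M G = 6 := by exact_mod_cast hG6
    omega
  have h := eRk_eq_kColoops_add_sdiff hGg hSG hKS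
  rw [eRk_eq_rkN, eRk_eq_rkN, hk, h6] at h
  have h' : ((6 : ℕ) : ℕ∞) = ((2 + rkN M (S \ coloops M G) : ℕ) : ℕ∞) := by
    rw [Nat.cast_add]; exact_mod_cast h
  have h'' : 6 = 2 + rkN M (S \ coloops M G) := by exact_mod_cast h'
  omega

open scoped Classical in
/-- **A target that is not bad has at most one thin covering preimage**: two of them are faces `S ∖ w`, `S ∖ w′` with
`w ≠ w′` coloops of `S ∖ K`, and `(S ∖ K) ∖ {w, w′}` has rank `4 − 2 = 2`. -/
theorem card_thin_coverPreimages_le_one_of_not_bad (hG : G ∈ flatsQ M (5 + 1)) (hd : (gr M \ G).card = 3)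
    (hk : kColoops M G = 2) {S : Finset α} (hS : S ∈ shadowAt M (5 + 2) 5 (Uq M (5 + 2) 5) G)
    (hnb : ¬ BadTarget M G S) :
    ((coverPreimages M (Uq M (5 + 2) 5) G S).filter (fun B => B ∉ lay0 M 5 G)).card ≤ 1 := by
  have hd' : (gr M \ G).card ≤ 5 := by omega
  have hGg : G ⊆ gr M := (mem_flatsQ.1 hG).1
  have hSG : S ⊆ G := subset_G_of_mem_shadowAt hS
  have hsub := thin_coverPreimages_subset_image_coloops hG hd' S
  rw [Finset.card_le_one]
  intro B hB B' hB'
  by_contra hne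
  obtain ⟨w, hw, rfl⟩ := Finset.mem_image.1 (hsub hB)
  obtain ⟨w', hw', rfl⟩ := Finset.mem_image.1 (hsub hB')
  have hww' : w ≠ w' := by
    rintro rfl; exact hne rfl
  apply hnb
  set X := S \ coloops M G with hX
  have hXg : X ⊆ gr M := Finset.sdiff_subset.trans (hSG.trans hGg)
  have hwX : w ∈ X := (mem_coloops.1 hw).1
  have hw'X : w' ∈ X := (mem_coloops.1 hw').1
  refine ⟨w, hwX, w', hw'X, hww', ?_⟩
  have hr4 : rkN M X = 4 := rkN_sdiff_coloops_eq_four hG hk hS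
  have h1 : rkN M X = rkN M (X.erase w) + 1 := rkN_erase_of_mem_coloops hXg hw
  have hw'c : w' ∈ coloops M (X.erase w) := by
    rw [mem_coloops]
    refine ⟨Finset.mem_erase.2 ⟨hww'.symm, hw'X⟩, fun h => (mem_coloops.1 hw').2 ?_⟩
    exact clF_mono (Finset.erase_subset_erase w' (Finset.erase_subset w X)) h
  have h2 : rkN M (X.erase w) = rkN M ((X.erase w).erase w') + 1 :=
    rkN_erase_of_mem_coloops ((Finset.erase_subset w X).trans hXg) hw'c
  have he : X \ {w, w'} = (X.erase w).erase w' := by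
    ext a
    simp only [Finset.mem_sdiff, Finset.mem_insert, Finset.mem_singleton, Finset.mem_erase, not_or]
    tauto
  rw [he]
  omega

open scoped Classical in
/-- A target that is not bad has `L1 ≤ 7/30` (cell `(3, 2)`). -/
theorem L1_le_of_not_bad (hG : G ∈ flatsQ M (5 + 1)) (hd : (gr M \ G).card = 3) (hk : kColoops M G = 2)
    {S : Finset α} (hS : S ∈ shadowAt M (5 + 2) 5 (Uq M (5 + 2) 5) G) (hnb : ¬ BadTarget M G S) :
    L1 M 5 G S ≤ 7 / 30 := by
  have hc := card_thin_coverPreimages_le_one_of_not_bad hG hd hk hS hnb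
  unfold L1
  set P := (coverPreimages M (Uq M (5 + 2) 5) G S).filter (fun B => B ∉ lay0 M 5 G) with hP
  have hthin : ∀ B ∈ P, B ∈ thinMembers M 5 G := by
    intro B hB
    rw [hP, Finset.mem_filter, mem_coverPreimages] at hB
    exact mem_thinMembers.2 ⟨hB.1.1, hB.2⟩
  calc ∑ B ∈ P, req M 5 B ≤ ∑ _B ∈ P, (7 / 30 : ℚ) :=
        Finset.sum_le_sum (fun B hB => req_le_of_thin_three_two hG hd (hthin B hB))
    _ = (P.card : ℚ) * (7 / 30) := by rw [Finset.sum_const, nsmul_eq_mul]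
    _ ≤ 1 * (7 / 30) := by
        have : (P.card : ℚ) ≤ 1 := by exact_mod_cast hc
        nlinarith
    _ = 7 / 30 := by norm_num

open scoped Classical in
/-- **A target that is not bad keeps `cap2 ≥ 11/60`** (cell `(3, 2)`): it is unsaturated with `L1 ≤ 7/30 < 5/12 ≤ capS`. -/
theorem cap2_ge_of_not_bad (hG : G ∈ flatsQ M (5 + 1)) (hd : (gr M \ G).card = 3) (hk : kColoops M G = 2)
    {S : Finset α} (hS : S ∈ shadowAt M (5 + 2) 5 (Uq M (5 + 2) 5) G) (hnb : ¬ BadTarget M G S) :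
    11 / 60 ≤ cap2 M 5 G S := by
  have hL1 := L1_le_of_not_bad hG hd hk hS hnb
  have hcap := capS_ge_five_twelfths_three_two hd hk (subset_G_of_mem_shadowAt hS)
  have hle : L1 M 5 G S ≤ capS M 5 G S := by linarith
  unfold cap2 fS
  rw [if_pos hle]
  linarith

open scoped Classical in
/-- **THE STRUCTURE OF A BAD TARGET ABOVE A COVERING BASIS**: if `K ∪ T` (`T` a basis of `V`, four points) lies in a bad
target `S` via `w, w′`, then `w, w′ ∈ T` and `(S ∖ K) ∖ {w, w′} ⊆ cl (T ∖ {w, w′})` — the target is a subset of the line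
through the two other basis points plus `{w, w′}`. -/
theorem bad_target_structure (hG : G ∈ flatsQ M (5 + 1)) (hk : kColoops M G = 2)
    (hs : ∀ e ∈ gr M, ∀ f ∈ gr M, e ≠ f → rkN M {e, f} = 2)
    {Q : Finset α} (hQ : Q ∈ shadowAt M (5 + 2) 5 (Uq M (5 + 2) 5) G) (hQc : (Q \ coloops M G).card = 4)
    {S : Finset α} (hS : S ∈ shadowAt M (5 + 2) 5 (Uq M (5 + 2) 5) G) (hQS : Q ⊆ S)
    {w w' : α} (hw : w ∈ S \ coloops M G) (hw' : w' ∈ S \ coloops M G) (hne : w ≠ w')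
    (hr : rkN M ((S \ coloops M G) \ {w, w'}) ≤ 2) :
    w ∈ Q ∧ w' ∈ Q ∧ (S \ coloops M G) \ {w, w'} ⊆ clF M ((Q \ coloops M G) \ {w, w'}) := by
  have hk' : kColoops M G + 4 = 5 + 1 := by omega
  have hGg : G ⊆ gr M := (mem_flatsQ.1 hG).1
  have hSG : S ⊆ G := subset_G_of_mem_shadowAt hS
  have hQG : Q ⊆ G := subset_G_of_mem_shadowAt hQ
  set X := (S \ coloops M G) \ {w, w'} with hX
  set T := Q \ coloops M G with hT
  have hXg : X ⊆ gr M := Finset.sdiff_subset.trans (Finset.sdiff_subset.trans (hSG.trans hGg))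
  have hTI : M.Indep (T : Set α) :=
    (indep_of_mem_shadowAt_card hk' hQ hQc).subset (by exact_mod_cast (Finset.sdiff_subset : T ⊆ Q))
  have hTX : T \ {w, w'} ⊆ X := by
    intro a ha
    rw [Finset.mem_sdiff] at ha
    rw [hX, Finset.mem_sdiff]
    exact ⟨Finset.sdiff_subset_sdiff hQS (Finset.Subset.refl _) ha.1, ha.2⟩
  -- `T ∖ {w, w′}` is independent of rank `≤ 2`, hence has at most two points: `w, w′ ∈ T`
  have hTX' : M.Indep ((T \ {w, w'} : Finset α) : Set α) :=
    hTI.subset (by exact_mod_cast (Finset.sdiff_subset : T \ {w, w'} ⊆ T))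
  have hcard : (T \ {w, w'}).card ≤ 2 := by
    have h1 : rkN M (T \ {w, w'}) = (T \ {w, w'}).card := by
      have h := hTX'.eRk_eq_encard
      rw [eRk_eq_rkN, Set.encard_coe_eq_coe_finsetCard] at h
      exact_mod_cast h
    have h2 : rkN M (T \ {w, w'}) ≤ rkN M X := rkN_mono hTX
    omega
  have hwT : w ∈ T ∧ w' ∈ T := by
    by_contra hcon
    have hsub : ({w, w'} ∩ T).card ≤ 1 := by
      rw [Finset.card_le_one]
      intro a ha b hb
      rw [Finset.mem_inter, Finset.mem_insert, Finset.mem_singleton] at ha hb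
      by_contra hab
      apply hcon
      rcases ha.1 with rfl | rfl <;> rcases hb.1 with rfl | rfl
      · exact absurd rfl hab
      · exact ⟨ha.2, hb.2⟩
      · exact ⟨hb.2, ha.2⟩
      · exact absurd rfl hab
    have := Finset.card_sdiff_add_card_inter T {w, w'}
    rw [Finset.inter_comm] at this
    omega
  refine ⟨(Finset.mem_sdiff.1 hwT.1).1, (Finset.mem_sdiff.1 hwT.2).1, ?_⟩
  -- `T ∖ {w, w′}` has exactly two points, so `X ⊆ cl (T ∖ {w, w′})`
  have hcard2 : (T \ {w, w'}).card = 2 := by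
    have hsub : {w, w'} ⊆ T := by
      intro a ha
      rw [Finset.mem_insert, Finset.mem_singleton] at ha
      rcases ha with rfl | rfl
      · exact hwT.1
      · exact hwT.2
    rw [Finset.card_sdiff_of_subset hsub, hQc, Finset.card_pair hne]
  have hinter : X ∩ (T \ {w, w'}) = T \ {w, w'} := Finset.inter_eq_right.2 hTX
  have := subset_clF_inter_of_rkN_le_two hs hXg hr (X' := T \ {w, w'}) (by rw [hinter, hcard2])
  rwa [hinter] at this

end NonBad

end PercRepro.Shadow
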